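import Literature.NumberTheory.EllipticCurves.ArtinFormalismQuadraticLocalProofs
import Literature.NumberTheory.EllipticCurves.HasseWeilAbelianCoinvariantsProofs
import Summits.BirchSwinnertonDyer.BirchSwinnertonDyer.Theorems.PlecticLegsArtinBaseChangeCharPoly

/-!
# Artin formalism for an unramified base change, one place at a time

Route `PlecticLegs`, support item `ArtinBaseChange` (stmt-BirchSwinnertonDyer-18261). For an
elliptic curve `W/ℚ`, a finite Galois extension `F/ℚ`, a finite place `v` of `ℚ` and a place
`w ∣ v` of `F` **unramified** over `v` (`e(w|v) = 1`) of residue degree `f = f(w|v)`, the local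
polynomial of `W_F` at `w` is obtained from that of `W` at `v` by raising the Frobenius
eigenvalues to the `f`-th power: if `L_v(W, T) = 1 - t T + δ T²` then
`L_w(W_F, T) = 1 - s_f(t, δ) T + δ^f T²` with `s_f = α^f + β^f = D_f(t, δ)` the Newton power
sums (Mathlib's Dickson polynomial `Polynomial.dickson 1 δ f` evaluated at `t`).  Proof through the `ℓ`-adic Tate module exactly as the tree's quadratic case
`WeierstrassCurve.localPolynomialAt_baseChange_quadratic` (inert primes): both polynomials are
reversed characteristic polynomials of Frobenius on inertia coinvariants
(`reverse_charpoly_toInertiaCoinvariants_eq_localPolynomialAt`), `V_ℓ(W_F) ≅ V_ℓ(W)|_{Γ_F}`,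
at an unramified place `I_𝔓 ≤ res(Γ_F)` so the coinvariants agree, and a Frobenius of `F` at
`w` restricts to `Frob_v^f` modulo inertia; the linear algebra is
`reverse_charpoly_pow_of_finrank_le_two`.

## References

* J. H. Silverman, *The Arithmetic of Elliptic Curves*, 2nd ed. (2009), V.2.3.1, §C.16.
* J. Neukirch, *Algebraic Number Theory* (1999), I §9.
* K. Ireland, M. Rosen, *A Classical Introduction to Modern Number Theory*, Prop. 20.5.4.
-/

noncomputable section

-- D-0017: single-problem summit, so `Summit.BirchSwinnertonDyer.BirchSwinnertonDyer.…` repeats a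
-- namespace BY DESIGN.
set_option linter.dupNamespace false

open scoped Classical NumberField
open Field IsDedekindDomain NumberField Polynomial

namespace Summit.BirchSwinnertonDyer.BirchSwinnertonDyer.Theorems

open WeierstrassCurve Literature.NumberTheory.EllipticCurves Literature.NumberTheory.GaloisRepresentations

/-- Every Mathlib local polynomial of a Weierstrass curve over a local field has the shape
`1 - t T + δ T²` (`1 - aT + qT²`, `1 ∓ T`, `1`). [folklore] -/
theorem exists_localPolynomial_eq (R : Type*) [CommRing R] [IsDomain R] [IsDiscreteValuationRing R]
    {K : Type*} [Field K] [Algebra R K] [IsFractionRing R K] (W : WeierstrassCurve K) :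
    ∃ t δ : ℤ, W.localPolynomial R = 1 - C t * X + C δ * X ^ 2 := by
  unfold localPolynomial
  split_ifs
  · exact ⟨_, _, rfl⟩
  · exact ⟨1, 0, by simp⟩
  · exact ⟨-1, 0, by simp⟩
  · exact ⟨0, 0, by simp⟩

variable (W : WeierstrassCurve ℚ) [W.IsElliptic] (F : Type) [Field F] [NumberField F] [IsGalois ℚ F]

set_option maxHeartbeats 1600000 in
/-- **Artin formalism at an unramified place** (Ireland–Rosen Prop. 20.5.4; Silverman, *AEC*,
V.2.3.1 `#E(𝔽_{q^f})` via `α^f + β^f`). Let `W/ℚ` be an elliptic curve, `F/ℚ` finite Galois,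
`w ∣ v` finite places with `e(w|v) = 1` and `f = f(w|v)`. If `L_v(W, T) = 1 - tT + δT²` then
`L_w(W_F, T) = 1 - s_f(t, δ) T + δ^f T²` for Mathlib's local polynomials (`localPolynomialAt`),
where `s_f(t, δ) = α^f + β^f = (dickson 1 δ f).eval t`. [folklore] -/
theorem localPolynomialAt_baseChange_of_ramificationIdx_eq_one
    {v : HeightOneSpectrum (𝓞 ℚ)} {w : HeightOneSpectrum (𝓞 F)}
    (hw : w.asIdeal.under (𝓞 ℚ) = v.asIdeal) (he : w.asIdeal.ramificationIdx (𝓞 ℚ) = 1)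
    {t δ : ℤ} (hv : W.localPolynomialAt v = 1 - C t * X + C δ * X ^ 2) :
    (W.baseChange F).localPolynomialAt w =
      1 - C ((dickson 1 δ (w.asIdeal.inertiaDeg (𝓞 ℚ))).eval t) * X +
        C (δ ^ w.asIdeal.inertiaDeg (𝓞 ℚ)) * X ^ 2 := by
  /- ### Setup: a prime `ℓ ∤ v`, the Tate modules -/
  haveI hEK : (W.baseChange F).IsElliptic := by rw [baseChange]; infer_instance
  set fdeg := w.asIdeal.inertiaDeg (𝓞 ℚ) with hfdeg
  have hfpos : 0 < fdeg := by
    rw [hfdeg]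
    haveI : w.asIdeal.IsMaximal := w.isMaximal
    haveI : w.asIdeal.LiesOver v.asIdeal := ⟨hw.symm⟩
    haveI : w.asIdeal.IsPrime := w.isPrime
    exact Ideal.inertiaDeg_pos w.asIdeal (𝓞 ℚ)
  obtain ⟨ℓ, hℓp, hℓv⟩ := HeightOneSpectrum.exists_prime_natCast_not_mem v
  haveI : Fact ℓ.Prime := ⟨hℓp⟩
  have hℓw : (ℓ : 𝓞 F) ∉ w.asIdeal := by
    intro hmem
    apply hℓv
    have : (ℓ : 𝓞 F) = algebraMap (𝓞 ℚ) (𝓞 F) ℓ := by simp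
    rw [this] at hmem
    rw [← hw, Ideal.under_def, Ideal.mem_comap]
    exact hmem
  haveI := W.module_finite_rationalTateModule_holds ℓ
  haveI := (W.baseChange F).module_finite_rationalTateModule_holds ℓ
  have hcW := W.continuous_rationalGaloisRepTate_holds ℓ
  have hcK := (W.baseChange F).continuous_rationalGaloisRepTate_holds ℓ
  set ρ := rationalTateGaloisRepOf (geomPoints W) ℓ hcW with hρ
  set ρK := rationalTateGaloisRepOf (geomPoints (W.baseChange F)) ℓ hcK with hρK
  obtain ⟨EK, hEK⟩ := W.exists_rationalTateModule_equiv_baseChange F ℓ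
  /- ### The primes: `𝔔 ∣ w`, a Frobenius `Φ` of `F`, `𝔓 = ι⁻¹ 𝔔 ∣ v`, a Frobenius `φ` of `ℚ` -/
  obtain ⟨𝔔, h𝔔⟩ := HeightOneSpectrum.primesAbove_nonempty w
  haveI : 𝔔.IsPrime := h𝔔.1
  obtain ⟨Φ, hΦ⟩ := HeightOneSpectrum.exists_isArithFrobAt_of_mem_primesAbove_holds h𝔔
  set 𝔓 := 𝔔.comap (absIntegersMap ℚ F) with h𝔓def
  have h𝔓 : 𝔓 ∈ v.primesAbove := comap_absIntegersMap_mem_primesAbove hw h𝔔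
  haveI : 𝔓.IsPrime := h𝔓.1
  set DQ := 𝔔.decompositionSubgroup (absoluteGaloisGroup F) with hDQ
  set DP := 𝔓.decompositionSubgroup (absoluteGaloisGroup ℚ) with hDP
  have hΦD : Φ ∈ DQ := hΦ.mem_stabilizer
  have hresD : ∀ γ : absoluteGaloisGroup F, γ ∈ DQ → absGaloisRestrict ℚ F γ ∈ DP := by
    intro γ hγ
    have h : γ ∈ DP.comap (absGaloisRestrict ℚ F).toMonoidHom := by
      rw [hDP, h𝔓def, comap_decompositionSubgroup_comap_absIntegersMap ℚ F 𝔔]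
      exact hγ
    exact h
  -- the restriction `D_𝔔 → D_𝔓`
  set f : DQ →* DP := ((absGaloisRestrict ℚ F).toMonoidHom.comp DQ.subtype).codRestrict DP
    (fun γ ↦ hresD γ γ.2) with hfdef
  have hfval : ∀ γ : DQ, ((f γ : DP) : absoluteGaloisGroup ℚ) = absGaloisRestrict ℚ F γ :=
    fun _ ↦ rfl
  set ID : Subgroup DP := 𝔓.inertia DP with hID
  haveI : ID.Normal := inferInstanceAs (𝔓.inertia DP).Normal
  set ρD : Representation ℚ_[ℓ] DP (W.rationalTateModule ℓ) := ρ.toRepresentation.comp DP.subtype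
    with hρD
  have hmemID : ∀ x : DP, x ∈ ID ↔ (x : absoluteGaloisGroup ℚ) ∈ 𝔓.inertia (absoluteGaloisGroup ℚ) :=
    fun x ↦ Iff.rfl
  have hmemIQ : ∀ y : DQ, y ∈ 𝔔.inertia DQ ↔
      (y : absoluteGaloisGroup F) ∈ 𝔔.inertia (absoluteGaloisGroup F) :=
    fun y ↦ Iff.rfl
  obtain ⟨φ, hφ⟩ := HeightOneSpectrum.exists_isArithFrobAt_of_mem_primesAbove_holds h𝔓
  have hφD : φ ∈ DP := hφ.mem_stabilizer
  /- ### Euler factors as characteristic polynomials -/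
  have hinjmap : Function.Injective (Polynomial.map (Int.castRingHom ℚ_[ℓ])) :=
    Polynomial.map_injective _ (RingHom.injective_int _)
  -- `L_v(W)` at `φ`
  have hP : (ρD.toCoinvariants ID ⟨φ, hφD⟩).charpoly.reverse =
      (W.localPolynomialAt v).map (Int.castRingHom ℚ_[ℓ]) :=
    W.reverse_charpoly_toInertiaCoinvariants_eq_localPolynomialAt ℓ hcW hℓv h𝔓 ⟨φ, hφD⟩ hφ
  -- at an unramified place the inertia of `F` maps ONTO `I_𝔓`
  have hIle : 𝔓.inertia (absoluteGaloisGroup ℚ) ≤ (absGaloisRestrict ℚ F).range := by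
    have he' : v.asIdeal.ramificationIdxIn (𝓞 F) = 1 := by
      haveI : w.asIdeal.IsPrime := w.isPrime
      haveI : v.asIdeal.IsMaximal := v.isMaximal
      haveI : w.asIdeal.LiesOver v.asIdeal := ⟨hw.symm⟩
      haveI : IsGaloisGroup (F ≃ₐ[ℚ] F) (𝓞 ℚ) (𝓞 F) := IsGaloisGroup.of_isFractionRing _ _ _ ℚ F
      rw [Ideal.ramificationIdxIn_eq_ramificationIdx v.asIdeal w.asIdeal (F ≃ₐ[ℚ] F), he]
    exact inertia_le_range_absGaloisRestrict ℚ F he' h𝔓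
  have hS : ID = (𝔔.inertia DQ).map f := by
    ext x
    rw [Subgroup.mem_map]
    constructor
    · intro hxI
      obtain ⟨γ₀, hγ₀⟩ := hIle ((hmemID x).mp hxI)
      have hγ₀I : γ₀ ∈ 𝔔.inertia (absoluteGaloisGroup F) := by
        rw [← comap_inertia_comap_absIntegersMap ℚ F 𝔔, Subgroup.mem_comap, hγ₀]
        exact (hmemID x).mp hxI
      refine ⟨⟨γ₀, Ideal.inertia_le_decompositionSubgroup _ _ hγ₀I⟩, hγ₀I, Subtype.ext ?_⟩
      rw [hfval]
      exact hγ₀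
    · rintro ⟨γ, hγ, rfl⟩
      rw [hmemID, hfval]
      exact absGaloisRestrict_mem_inertia_comap ℚ F ((hmemIQ γ).mp hγ)
  -- `L_w(W_F)` at `Φ`, transported to `ρD`
  have hQ : (ρD.toCoinvariants ID (f ⟨Φ, hΦD⟩)).charpoly.reverse =
      ((W.baseChange F).localPolynomialAt w).map (Int.castRingHom ℚ_[ℓ]) := by
    rw [← (W.baseChange F).reverse_charpoly_toInertiaCoinvariants_eq_localPolynomialAt ℓ hcK hℓw
      h𝔔 ⟨Φ, hΦD⟩ hΦ]
    congr 1
    symm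
    refine charpoly_toCoinvariants_eq_of_equiv ρD (ρK.toRepresentation.comp DQ.subtype) f EK.symm
      (fun g x ↦ ?_) ID (𝔔.inertia DQ) hS ⟨Φ, hΦD⟩
    apply EK.injective
    rw [LinearEquiv.apply_symm_apply]
    change (W.baseChange F).rationalGaloisRepTate ℓ (g : absoluteGaloisGroup F) x =
      EK (W.rationalGaloisRepTate ℓ (absGaloisRestrict ℚ F g) (EK.symm x))
    rw [hEK, LinearEquiv.apply_symm_apply]
  /- ### `res Φ ≡ φ^f (mod I_𝔓)` and the linear algebra -/
  have hrel : absGaloisRestrict ℚ F Φ * (φ ^ fdeg)⁻¹ ∈ 𝔓.inertia (absoluteGaloisGroup ℚ) :=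
    absGaloisRestrict_mul_pow_inv_mem_inertia hw h𝔔 hΦ hφ
  have hrel' : f ⟨Φ, hΦD⟩ * ((⟨φ, hφD⟩ : DP) ^ fdeg)⁻¹ ∈ ID := by
    rw [hmemID]
    exact hrel
  set M : Module.End ℚ_[ℓ] (Representation.Coinvariants (ρD.comp ID.subtype)) :=
    ρD.toCoinvariants ID ⟨φ, hφD⟩ with hMdef
  have hQ' : ((W.baseChange F).localPolynomialAt w).map (Int.castRingHom ℚ_[ℓ]) =
      (M ^ fdeg).charpoly.reverse := by
    rw [← hQ, toCoinvariants_eq_of_mul_inv_mem ρD ID hrel', map_pow]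
  -- the coinvariants have dimension `≤ 2`
  have hdim : Module.finrank ℚ_[ℓ] (Representation.Coinvariants (ρD.comp ID.subtype)) ≤ 2 := by
    have h2 := W.finrank_rationalTateModule_geomPoints_eq_two ℓ
    unfold Representation.Coinvariants
    calc Module.finrank ℚ_[ℓ] (W.rationalTateModule ℓ ⧸ Representation.Coinvariants.ker (ρD.comp ID.subtype))
        ≤ Module.finrank ℚ_[ℓ] (W.rationalTateModule ℓ) := Submodule.finrank_quotient_le _
      _ = 2 := h2
  have hPM : M.charpoly.reverse = 1 - C (t : ℚ_[ℓ]) * X + C (δ : ℚ_[ℓ]) * X ^ 2 := by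
    rw [hMdef, hP, hv]
    simp [Polynomial.map_sub, Polynomial.map_mul]
  have key := reverse_charpoly_pow_of_finrank_le_two hdim M hPM hfpos
  apply hinjmap
  have hcast : (((dickson 1 δ fdeg).eval t : ℤ) : ℚ_[ℓ]) =
      (dickson 1 (δ : ℚ_[ℓ]) fdeg).eval (t : ℚ_[ℓ]) := by
    have h := map_dickson_eval (Int.castRingHom ℚ_[ℓ]) t δ fdeg
    simpa only [eq_intCast] using h
  rw [hQ', key]
  simp [Polynomial.map_sub, Polynomial.map_mul]
  rw [← hcast, Polynomial.C_eq_intCast]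

end Summit.BirchSwinnertonDyer.BirchSwinnertonDyer.Theorems

end
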